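import Mathlib.RingTheory.PowerSeries.Binomial
import Mathlib.NumberTheory.Padics.MahlerBasis
import Mathlib.RingTheory.PowerSeries.Substitution
import Literature.NumberTheory.EllipticCurves.Sprung2017.HalfLogarithmMatrixLimit
import Literature.NumberTheory.EllipticCurves.TwistedLValueSeries
import HarnessLib

/-!
# Sprung 2017, Thm. 1.1 + Thm. 4.13 / Cor. 4.14 (with Mazur–Tate–Teitelbaum §I.17) at `(p, a_p) = (3, ±3)`:
# the FUNCTIONAL EQUATION of the TRACE COORDINATES `(G₁, G₂) = (L♯, L♭)·ℒ` — named fact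

Topic `NumberTheory/EllipticCurves`, cluster `Sprung2017`. ONE named fact (`def … : Prop`, D-0014; nothing
asserted, no `_holds`), companion of `SharpFlatFunctionalEquation.lean` (the `a_p = 0` display of
Cor. 4.14, `cor414_sharpFlat_functionalEquation_apZero`, whose dictionary — sign `σ` via `IsFrickeEigen N f
(−σ)`, exponent `c` of `⟨N⟩ = γ^c` via the Teichmüller hypothesis, `ι` with `(1+T)(ι+1) = 1` — is used
VERBATIM here) and of `HalfLogarithmMatrixLimit.lean` (the α-free half-logarithm matrix
`ℒ(3, 3b) = halfLogMatrix b = lim 𝒞_1⋯𝒞_n C^{−(n+2)}`, b = ±1).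

## Source and reading
F. Sprung, *On pairs of `p`-adic `L`-functions for weight-two modular forms*, Algebra & Number Theory 11
(2017) [Sprung2017] (held `paper:arxiv-1601.00010`): **Thm. 1.1** (p. 4) "`(L_p(f,α,T), L_p(f,β,T)) =
(L♯_p(f,T), L♭_p(f,T))·Log_{α,β}(1+T)`", `Log_{α,β} := lim_{n→∞} 𝒞_1⋯𝒞_n C^{−(n+2)}(−1 −1; β α)`, the
pair being UNIQUE when `p` is supersingular and being the tree's `IsSprungPair` pair (Cor. 4.4–4.5 / Thm.
1.12; tree `IsSprungPair.unique`); **Thm. 4.13** (p. 18): "`(L̂♯, L̂♭)(T)·L̂og_{α,β}(1+T) =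
−ε(−1)ω^{−i}(−N)(1+T)^{−log_γ(N)}(L̂♯, L̂♭)(f*, ω^{−i}, 1/(1+T) − 1)·L̂og_{α*,β*}(1+T)`", whose proof
"follows from the functional equations for `L̂_p(f,α,ωⁱ,T)` and `L̂_p(f,β,ωⁱ,T)`, which formally display
exactly the same invariance under the substitution `T ↦ 1/(1+T) − 1`, cf. [mtt]" — i.e. Mazur–Tate–
Teitelbaum, Invent. Math. 84 (1986) §I.17 for BOTH roots (both are allowable at a supersingular prime:
`v(α) = v(β) = 1/2`), with the COMMON multiplier `−c_N(1+T)^{−log_γ N}` for an elliptic curve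
(`f* = −c_N f`, Cor. 4.14). READING ("trace coordinates", α-free): with `ℒ := lim 𝒞_1⋯𝒞_n C^{−(n+2)}`
(so `Log_{α,β} = ℒ·(−1 −1; β α)`) and `(G₁, G₂) := (L♯, L♭)·ℒ`, Thm. 1.1 reads
`(G₁, G₂)·(−1 −1; β α) = (L_α, L_β)`; as the right factor is a CONSTANT invertible matrix (`α ≠ β`), each
`G_j` is a constant linear combination of `L_α` and `L_β`, hence satisfies their common functional
equation. In the tree's dictionary (the one of `cor414_sharpFlat_functionalEquation_apZero`, under which
the `p = 2` instance is PROVED and under which, at `a_p = 0`, the present statement FOLLOWS from that fact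
and `log^±((1+T)^{−1} − 1) = (1+T)^{−a}log^±` with `(p+1)a = −p`, resp. `−b`, `(p+1)b = −1`, §3.5):
`G_j(T^ι) = σ·(1+T)^c·G_j(T)`.

SPECIAL CASE typed (the only one an elliptic curve over `ℚ` needs at an odd supersingular prime with
`a_p ≠ 0`): `p = 3`, `a_3 = 3b`, `b = ±1`, trivial tame character; `ℒ` = the tree DEFINITION
`halfLogMatrix b` (coefficientwise `3`-adic limit, convergence PROVED in `HalfLogarithmMatrixLimit.lean`).
-- TODO(general form): any good supersingular `(p, a_p)` (needs the convergence of `ℒ(p, a_p)` in that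
-- generality, Sprung 2017 Lemma 3.3 / Main Lemma), the branches `ωⁱ`, and the completed pair
-- `(L̂♯, L̂♭) = (L♯, L♭)·Log·L̂og⁻¹` (Cor. 4.6) with its componentwise functional equation (Cor. 4.14).
HONEST FRAMING: statement only; net debt +1; weaker than print (one curve class, `i = 0`), never stronger.
Consumer (kernel, Summits side): stub S0 `stub_bothColours` of the crux line `chromatic-common-zeros`
(stmt-BirchSwinnertonDyer-19875): with the PROVED non-vanishing of the row twists of `ℒ(3, ±3)`
(`rowTwist_halfLogMatrix_ne_zero`, `HalfLogarithmMatrixTwistProofs.lean`) this fact gives `L♯ ≠ 0 ∧ L♭ ≠ 0`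
on class X8 — Sprung 2017 Conj. 4.12 / 2012 Conj. 6.15 at `(3, ±3)`. BSD is not proved by any of this.
-/

noncomputable section

open scoped MatrixGroups ModularForm

open CongruenceSubgroup PowerSeries WeierstrassCurve Literature.NumberTheory.EllipticCurves
  Literature.NumberTheory.EllipticCurves.ModularForms

namespace Literature.NumberTheory.EllipticCurves.Sprung2017

/-- **Sprung 2017, Thm. 1.1 + Thm. 4.13 (Mazur–Tate–Teitelbaum §I.17 for both roots) at `p = 3`,
`a_3 = ±3` — the functional equation of the TRACE COORDINATES.** For `W/ℚ` elliptic and globally minimal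
with good reduction at `3` and `a_3(W) = 3b`, `b = ±1`, `f ∈ S₂(Γ₀(N))` its newform, a sign `σ = ±1` with
`w_N f = −σ f`, the `3`-adic exponent `c` of `⟨N⟩` (`N = η_N γ^c`), `ι = T^ι` (`(1+T)(1+ι) = 1`), and
every Sprung pair `(L♯, L♭)` of `f` at `3` (`IsSprungPair f 3 (3b) L♯ L♭`): each trace coordinate
`G_j := L♯·ℒ_{0j} + L♭·ℒ_{1j}` (`ℒ = halfLogMatrix b`, `j = 0, 1`; `L♯, L♭` read in `ℚ_3⟦T⟧`) satisfies
`G_j(T^ι) = σ · (1+T)^c · G_j(T)`.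
Print: Thm. 1.1 `(L_α, L_β) = (L♯, L♭)Log_{α,β}`, `Log_{α,β} = ℒ·(−1 −1; β α)`; Thm. 4.13 / Cor. 4.14:
`(L_α, L_β)(T) = −c_N(1+T)^{−log_γ N}(L_α, L_β)(T^ι)` (MTT §I.17 for `α` and for `β`); hence the same for
the constant combinations `G_j`. Dictionary = that of `cor414_sharpFlat_functionalEquation_apZero`.
Named fact; nothing asserted; no `_holds`. Special case of print (`p = 3`, `a_3 = ±3`, `i = 0`).
[cite: Sprung2017, Thm. 1.1, Thm. 4.13 and Cor. 4.14 (with Cor. 4.4–4.5)]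
[cite: MazurTateTeitelbaum1986Invent, §I.17] [cite: GreenbergLNM1716, §1 (pp. 67–68)] -/
def thm413_traceCoordinate_functionalEquation_three : Prop :=
  ∀ (W : WeierstrassCurve ℚ) [W.IsElliptic] [W.IsGloballyMinimal] (N : ℕ) [NeZero N]
    (f : CuspForm (Gamma0 N) 2) (b : ℤ), (b = 1 ∨ b = -1) →
    IsNewformOf W f → W.HasGoodReductionAtPrime 3 → W.frobeniusTrace 3 = 3 * b →
  ∀ (σ : ℤ), σ ^ 2 = 1 → IsFrickeEigen N f (-(σ : ℂ)) →
  ∀ (ηN : rootsOfUnity (torsionOrder 3) ℤ_[3]) (c : ℤ_[3]),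
    (∀ n : ℕ, PadicInt.toZModPow (n + cyclotomicExponent 3) ((ηN : ℤ_[3]ˣ) : ℤ_[3]) *
      (cyclotomicGenerator 3 : ZMod (3 ^ (n + cyclotomicExponent 3))) ^
        (PadicInt.toZModPow n c).val = (N : ZMod (3 ^ (n + cyclotomicExponent 3)))) →
  ∀ (ι : PowerSeries ℚ_[3]), (1 + PowerSeries.X : PowerSeries ℚ_[3]) * (ι + 1) = 1 →
  ∀ (Ls Lf : IwasawaAlgebra 3), IsSprungPair f 3 (3 * b) Ls Lf →
  ∀ j : Fin 2,
    PowerSeries.subst ι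
        (iwasawaToPowerSeries 3 Ls * halfLogMatrix b 0 j + iwasawaToPowerSeries 3 Lf * halfLogMatrix b 1 j) =
      (σ : PowerSeries ℚ_[3]) * (PowerSeries.binomialSeries ℤ_[3] c).map (algebraMap ℤ_[3] ℚ_[3]) *
        (iwasawaToPowerSeries 3 Ls * halfLogMatrix b 0 j + iwasawaToPowerSeries 3 Lf * halfLogMatrix b 1 j)

end Literature.NumberTheory.EllipticCurves.Sprung2017

end
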